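import Summits.CriticalPhenomena.PercolationContinuityZ3.Theorems.PercNearOneGluingNoHeavyLowerTailAntitheticPendantArms
import Summits.CriticalPhenomena.PercolationContinuityZ3.Theorems.PercNearOneGluingNoHeavyLowerTailAntitheticDegTwoOneSided
import HarnessLib

/-!
# `NoHeavyLowerTail` (stmt-CriticalPhenomena-4575) — antithetic cluster pairs: the HANDLE PRINCIPLE (HOME/THEOREM-Theta.md §3 Remark (a),
# prim-hp-2 gen 62)

Support file (`--supports stmt-CriticalPhenomena-4575`, hull-port prover `prim-hp-2`, gen 62).  No definitions, no named facts, no sorries;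
standard axioms.  VERTEX version; notation of …AntitheticPendantArms (`X T = openCluster (T ∩ E) s`, `Y T = openCluster (Tᶜ ∩ E) s`,
`⊕_E(P; K) = Σ_{T : P ∈ X} K₁K₂(X,Y)`, `TII_E(P, Q; K) = Σ_{T : P ∈ X, Q ∉ Y} K₁K₂(X,Y)`, 𝒮 = super-odd twisted-monotone pairs `K₁, K₂`).

THE HANDLE PRINCIPLE.  Let `K` be ANY finite graph (edge set `E₀` without loops) through the source `s`, `P, Q` vertices of `K`, and let
`G = K ∪ (P – u 1 – … – u a = y) ∪ (Q – w 1 – … – w b = z) + xy + xz` be `K` with a HANDLE through the fresh vertex `x` (arms of fresh vertices,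
`a, b ≥ 0`, `yz ∉ H`).  If
  (⊕) `K ∪ (stub w 1 … w j)` is ⊕-positive at `P` for every `j < b` (all `K ∈ 𝒮`), and
  (M) the MIXED sum of `K` is nonnegative: `TII_{E₀}(P, Q; K) ≥ 0` for all `K ∈ 𝒮`,
then TERM II of the deg-2 elimination at `x` is `≥ 0` (`Antithetic.Pendant.handle_termTwo_nonneg_of`) and hence the vertex antithetic inequality
at `R = {x}` holds for `G` (`Antithetic.Pendant.handle_vertex_sum_nonneg_of`, via `DegTwo.deg2_vertex_of_termTwo`).  THEOREM Θ
(…AntitheticHandle) is the instance `K` = cycle (THEOREM ⊕-CYCLE and PR4 supply (⊕) and (M)); further instances only need the two box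
decompositions for `K`.
[cite: VandenbergHaggstromKahn2005, §1 p. 6 ("Harris' inequality"), §1 p. 3 (open cluster `C_s`)]
-/

noncomputable section

namespace Summit.CriticalPhenomena.PercolationContinuityZ3.Theorems

open Literature.Probability.Percolation
open scoped Classical

namespace Antithetic

namespace Pendant

variable {V : Type*} [Fintype V] {E₀ : Set (Sym2 V)} {s P Q : V} {u w : ℕ → V} {a b : ℕ}
  (hu0 : u 0 = P) (hw0 : w 0 = Q)
  (hufresh : ∀ i, 0 < i → i ≤ a → ∀ f ∈ E₀ ∪ Cyc.edgeSet b w, u i ∈ f → f.IsDiag)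
  (hwfresh : ∀ i, 0 < i → i ≤ b → ∀ f ∈ E₀, w i ∈ f → f.IsDiag)
  (huinj : ∀ i j, i ≤ a → j ≤ a → u i = u j → i = j) (hwinj : ∀ i j, i ≤ b → j ≤ b → w i = w j → i = j)
  (hsu : ∀ i, 0 < i → i ≤ a → s ≠ u i) (hsw : ∀ i, 0 < i → i ≤ b → s ≠ w i)
  (hPw : ∀ i, 0 < i → i ≤ b → P ≠ w i) (hzu : ∀ i, 0 < i → i ≤ a → w b ≠ u i)
  (hoplus : ∀ j, j < b → ∀ K₁ K₂ : Set V → Set V → ℝ,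
    (∀ ⦃A A' B B' : Set V⦄, A ⊆ A' → B' ⊆ B → K₁ A B ≤ K₁ A' B') → (∀ A B, 0 ≤ K₁ A B + K₁ B A) →
    (∀ ⦃A A' B B' : Set V⦄, A ⊆ A' → B' ⊆ B → K₂ A B ≤ K₂ A' B') → (∀ A B, 0 ≤ K₂ A B + K₂ B A) →
    0 ≤ ∑ T ∈ Finset.univ.filter (fun T : Set (Sym2 V) => P ∈ openCluster (T ∩ (E₀ ∪ Cyc.edgeSet j w)) s),
      K₁ (openCluster (T ∩ (E₀ ∪ Cyc.edgeSet j w)) s) (openCluster (Tᶜ ∩ (E₀ ∪ Cyc.edgeSet j w)) s) *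
        K₂ (openCluster (T ∩ (E₀ ∪ Cyc.edgeSet j w)) s) (openCluster (Tᶜ ∩ (E₀ ∪ Cyc.edgeSet j w)) s))
  (hmixed : ∀ K₁ K₂ : Set V → Set V → ℝ,
    (∀ ⦃A A' B B' : Set V⦄, A ⊆ A' → B' ⊆ B → K₁ A B ≤ K₁ A' B') → (∀ A B, 0 ≤ K₁ A B + K₁ B A) →
    (∀ ⦃A A' B B' : Set V⦄, A ⊆ A' → B' ⊆ B → K₂ A B ≤ K₂ A' B') → (∀ A B, 0 ≤ K₂ A B + K₂ B A) →
    0 ≤ ∑ T ∈ Finset.univ.filter (fun T : Set (Sym2 V) => P ∈ openCluster (T ∩ E₀) s ∧ Q ∉ openCluster (Tᶜ ∩ E₀) s),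
      K₁ (openCluster (T ∩ E₀) s) (openCluster (Tᶜ ∩ E₀) s) * K₂ (openCluster (T ∩ E₀) s) (openCluster (Tᶜ ∩ E₀) s))
include hu0 hw0 hufresh hwfresh huinj hwinj hsu hsw hPw hzu hoplus hmixed

/-- **Handle principle, TERM II.**  Under (⊕) and (M), for `H = (E₀ ∪ z-arm) ∪ y-arm` and every super-odd twisted-monotone pair `K₁, K₂`:
`0 ≤ Σ_{T : y ∈ X_H T, z ∉ Y_H T} K₁(X_H T, Y_H T)·K₂(X_H T, Y_H T)`. [this work] -/
theorem handle_termTwo_nonneg_of (K₁ K₂ : Set V → Set V → ℝ)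
    (hK₁ : ∀ ⦃A A' B B' : Set V⦄, A ⊆ A' → B' ⊆ B → K₁ A B ≤ K₁ A' B') (hso₁ : ∀ A B, 0 ≤ K₁ A B + K₁ B A)
    (hK₂ : ∀ ⦃A A' B B' : Set V⦄, A ⊆ A' → B' ⊆ B → K₂ A B ≤ K₂ A' B') (hso₂ : ∀ A B, 0 ≤ K₂ A B + K₂ B A) :
    0 ≤ ∑ T ∈ Finset.univ.filter (fun T : Set (Sym2 V) =>
        u a ∈ openCluster (T ∩ ((E₀ ∪ Cyc.edgeSet b w) ∪ Cyc.edgeSet a u)) s ∧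
          w b ∉ openCluster (Tᶜ ∩ ((E₀ ∪ Cyc.edgeSet b w) ∪ Cyc.edgeSet a u)) s),
      K₁ (openCluster (T ∩ ((E₀ ∪ Cyc.edgeSet b w) ∪ Cyc.edgeSet a u)) s)
          (openCluster (Tᶜ ∩ ((E₀ ∪ Cyc.edgeSet b w) ∪ Cyc.edgeSet a u)) s) *
        K₂ (openCluster (T ∩ ((E₀ ∪ Cyc.edgeSet b w) ∪ Cyc.edgeSet a u)) s)
          (openCluster (Tᶜ ∩ ((E₀ ∪ Cyc.edgeSet b w) ∪ Cyc.edgeSet a u)) s) := by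
  -- peel the `y`-arm (PR1)
  refine termTwo_path_nonneg hufresh huinj hsu hzu ?_ le_rfl K₁ K₂ hK₁ hso₁ hK₂ hso₂
  intro L₁ L₂ hL₁ hsoL₁ hL₂ hsoL₂
  rw [hu0]
  -- peel the `z`-arm (PR2), paying (⊕) for each remaining stub, and finish with (M)
  refine termTwo_stub_nonneg hwfresh hwinj hsw hPw ?_ ?_ le_rfl L₁ L₂ hL₁ hsoL₁ hL₂ hsoL₂
  · intro j hj M₁ M₂ hM₁ hsoM₁ hM₂ hsoM₂
    exact hoplus j hj M₁ M₂ hM₁ hsoM₁ hM₂ hsoM₂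
  · intro M₁ M₂ hM₁ hsoM₁ hM₂ hsoM₂
    rw [hw0]
    exact hmixed M₁ M₂ hM₁ hsoM₁ hM₂ hsoM₂

/-- **HANDLE PRINCIPLE** (HOME/THEOREM-Theta.md §3 Remark (a)).  `K` any loop-free finite graph (edge set `E₀`) through `s`; `P, Q` vertices of
`K`; arms `u 0 = P, …, u a = y` and `w 0 = Q, …, w b = z` of fresh vertices; `x` fresh, joined to `y` and `z`; `yz` not a pair of
`H = K ∪ arms`; `E = H + xy + xz`.  If (⊕) `K ∪ stub_j` is ⊕-positive at `P` for all `j < b` and (M) `TII_K(P, Q; K) ≥ 0` for all `K ∈ 𝒮`, then for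
all monotone `F, G`: `0 ≤ Σ_{ω : ¬(x ∈ X_E ω ∧ x ∈ Y_E ω)} (F(X_E ω) − F(Y_E ω))·(G(X_E ω) − G(Y_E ω))`. [this work] -/
theorem handle_vertex_sum_nonneg_of (hnd : ∀ f ∈ E₀, ¬ f.IsDiag) {x : V}
    (hx : ∀ f ∈ (E₀ ∪ Cyc.edgeSet b w) ∪ Cyc.edgeSet a u, x ∈ f → f.IsDiag)
    (hxs : x ≠ s) (hxy : x ≠ u a) (hxz : x ≠ w b) (hyz : u a ≠ w b) (hg : s(u a, w b) ∉ (E₀ ∪ Cyc.edgeSet b w) ∪ Cyc.edgeSet a u)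
    {F G : Set V → ℝ} (hF : Monotone F) (hG : Monotone G) :
    0 ≤ ∑ ω ∈ Finset.univ.filter (fun ω : Set (Sym2 V) =>
        ¬ ((openGraph (ω ∩ insert s(x, u a) (insert s(x, w b) ((E₀ ∪ Cyc.edgeSet b w) ∪ Cyc.edgeSet a u)))).Reachable s x ∧
          (openGraph (ωᶜ ∩ insert s(x, u a) (insert s(x, w b) ((E₀ ∪ Cyc.edgeSet b w) ∪ Cyc.edgeSet a u)))).Reachable s x)),
      (F (openCluster (ω ∩ insert s(x, u a) (insert s(x, w b) ((E₀ ∪ Cyc.edgeSet b w) ∪ Cyc.edgeSet a u))) s) -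
          F (openCluster (ωᶜ ∩ insert s(x, u a) (insert s(x, w b) ((E₀ ∪ Cyc.edgeSet b w) ∪ Cyc.edgeSet a u))) s)) *
        (G (openCluster (ω ∩ insert s(x, u a) (insert s(x, w b) ((E₀ ∪ Cyc.edgeSet b w) ∪ Cyc.edgeSet a u))) s) -
          G (openCluster (ωᶜ ∩ insert s(x, u a) (insert s(x, w b) ((E₀ ∪ Cyc.edgeSet b w) ∪ Cyc.edgeSet a u))) s)) := by
  set EH := (E₀ ∪ Cyc.edgeSet b w) ∪ Cyc.edgeSet a u with hEH
  -- `H` has no loops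
  have hnd' : ∀ f ∈ EH, ¬ f.IsDiag := by
    rintro f ((hf | ⟨i, hi, rfl⟩) | ⟨i, hi, rfl⟩)
    · exact hnd f hf
    · rw [Cyc.edge, Sym2.mk_isDiag_iff]; exact fun h => absurd (hwinj i (i + 1) (by omega) (by omega) h) (by omega)
    · rw [Cyc.edge, Sym2.mk_isDiag_iff]; exact fun h => absurd (huinj i (i + 1) (by omega) (by omega) h) (by omega)
  have he' : s(x, u a) ∉ EH := fun h => absurd (hx _ h (Sym2.mem_mk_left _ _)) (hnd' _ h)
  have hf' : s(x, w b) ∉ EH := fun h => absurd (hx _ h (Sym2.mem_mk_left _ _)) (hnd' _ h)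
  have hE' : insert s(x, u a) (insert s(x, w b) EH) \ {s(x, u a), s(x, w b)} = EH := by
    ext f
    simp only [Set.mem_sdiff, Set.mem_insert_iff, Set.mem_singleton_iff, not_or]
    constructor
    · rintro ⟨h1 | h1 | h1, h2, h3⟩
      · exact absurd h1 h2
      · exact absurd h1 h3
      · exact h1
    · intro h
      exact ⟨Or.inr (Or.inr h), fun h1 => he' (h1 ▸ h), fun h1 => hf' (h1 ▸ h)⟩
  refine DegTwo.deg2_vertex_of_termTwo (E := insert s(x, u a) (insert s(x, w b) EH)) hxs hxy hxz hyz
    (Set.mem_insert _ _) (Set.mem_insert_of_mem _ (Set.mem_insert _ _)) ?_ ?_ hF hG ?_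
  · -- `x` meets only the two new pairs
    intro h hh hxh
    rcases hh with h1 | h1 | h1
    · exact Or.inl h1
    · exact Or.inr h1
    · exact absurd (hx h h1 hxh) (hnd' h h1)
  · -- `yz` is not a pair
    intro h
    rcases h with h1 | h1 | h1
    · rcases Sym2.eq_iff.1 h1 with ⟨h2, -⟩ | ⟨-, h2⟩
      · exact hxy h2.symm
      · exact hxz h2.symm
    · rcases Sym2.eq_iff.1 h1 with ⟨h2, -⟩ | ⟨h2, -⟩
      · exact hxy h2.symm
      · exact hyz h2
    · exact hg h1
  · -- TERM II by the handle principle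
    rw [hE']
    have hK : ∀ {F : Set V → ℝ}, Monotone F →
        (∀ ⦃A A' B B' : Set V⦄, A ⊆ A' → B' ⊆ B → F (A ∪ {x}) - F B ≤ F (A' ∪ {x}) - F B') ∧
        (∀ A B : Set V, 0 ≤ (F (A ∪ {x}) - F B) + (F (B ∪ {x}) - F A)) := by
      intro F hF
      refine ⟨fun A A' B B' hA hB => sub_le_sub (hF (Set.union_subset_union_left _ hA)) (hF hB), fun A B => ?_⟩
      have h1 : F A ≤ F (A ∪ {x}) := hF Set.subset_union_left
      have h2 : F B ≤ F (B ∪ {x}) := hF Set.subset_union_left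
      linarith
    exact handle_termTwo_nonneg_of hu0 hw0 hufresh hwfresh huinj hwinj hsu hsw hPw hzu hoplus hmixed
      (fun A B => F (A ∪ {x}) - F B) (fun A B => G (A ∪ {x}) - G B) (hK hF).1 (hK hF).2 (hK hG).1 (hK hG).2

end Pendant

end Antithetic

end Summit.CriticalPhenomena.PercolationContinuityZ3.Theorems
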